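import Summits.AtomisticToContinuum.HydrodynamicLimit.Theses.CollisionIsometryCLT
import Literature.MathematicalPhysics.KineticTheory.HardSphereEulerProofs
import Literature.Analysis.FluidPDE.HardSphereFlowRegular

/-!
# `AprioriBounds` (stmt-AtomisticToContinuum-9519), negative knowledge 6/7: Gibbs invariance of the regularised flow and time averages

Load-bearing analysis of the crux `CollisionIsometryCLT.AprioriBounds` by the standing disprover
(`Cruxes/AprioriBounds/Disproof.lean`, refuter-cdisprove-stmt-AtomisticToContinuum-9519-0).

Two dynamical tools for statements about TIME AVERAGES along the deterministic hard-sphere flow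
at equilibrium:

* `measurePreserving_regFlow_localGibbsMeasure` — **the homogeneous local Gibbs law
  (`a₀ = 1`, `u₀ = 0`, any `θ̄`, `0 < σ < 1/2`) is invariant under the regularised Alexander flow**
  `Alexander.regFlow` (`HardSphereFlowRegular`: a genuine `HardSphereFlow`, a group on the whole
  phase space, jointly measurable, energy-conserving everywhere).  Proof: the law is
  `Liouville.withDensity (Z⁻¹ 𝟙_D ∏ M_{1,0,θ̄}(vᵢ))`, the density is a function of the kinetic
  energy on the hard-sphere domain (`tensorPow_homogeneous_eq`), both are invariant at EVERY point
  (`canonicalDensity_homogeneous_regFlow`: energy conservation; the domain is invariant because the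
  good set is and the flow is the identity off it), and Liouville measure is preserved
  (`Alexander.measurePreserving_regFlow`); `measurePreserving_withDensity_of_comp_eq` is the
  abstract step.  This discharges, for the regularised flow, the `GibbsInvariance`-type hypotheses
  that several routes of this sub-problem carry as statement items.
* `measure_setIntegral_orbit_le` — an abstract **Markov–Tonelli bound along a measure-preserving,
  jointly measurable flow** `T`: for measurable `F ≥ 0` with bounded orbits,
  `P{ω : ∫_{[0,t]} F(T_s ω) ds ≤ M} ≤ 2·P{F ≤ a}` whenever `M ≤ a t/2` (a small time-integral forces
  `F ∘ T_s ≤ a` for half the time; by Tonelli and invariance that is as rare as `F ≤ a` at time 0).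
-/

noncomputable section

open MeasureTheory ProbabilityTheory Filter Set Topology Metric
open scoped ENNReal

namespace Summit.AtomisticToContinuum.HydrodynamicLimit.Theorems

namespace AprioriBoundsNegative

open Literature.MathematicalPhysics.KineticTheory Literature.Analysis.FluidPDE

/-! ### Invariance of the homogeneous local Gibbs law under the regularised hard-sphere flow -/

/-- A measure-preserving map leaving a density invariant preserves the weighted measure. -/
theorem measurePreserving_withDensity_of_comp_eq {α : Type*} [MeasurableSpace α] {μ : Measure α}
    {T : α → α} (hT : MeasurePreserving T μ μ) {g : α → ℝ≥0∞} (hg : Measurable g)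
    (hgT : ∀ x, g (T x) = g x) :
    MeasurePreserving T (μ.withDensity g) (μ.withDensity g) := by
  refine ⟨hT.measurable, Measure.ext fun A hA => ?_⟩
  rw [Measure.map_apply hT.measurable hA, withDensity_apply _ (hA.preimage hT.measurable),
    withDensity_apply _ hA, ← lintegral_indicator (hA.preimage hT.measurable),
    ← lintegral_indicator hA]
  have : (T ⁻¹' A).indicator g = (A.indicator g) ∘ T := by
    funext x
    by_cases h : T x ∈ A
    · rw [Function.comp_apply, Set.indicator_of_mem h,
        Set.indicator_of_mem (show x ∈ T ⁻¹' A from h), hgT x]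
    · rw [Function.comp_apply, Set.indicator_of_notMem h,
        Set.indicator_of_notMem (show x ∉ T ⁻¹' A from h)]
  rw [this]
  exact hT.lintegral_comp (hg.indicator hA)

/-- The tensor power of the homogeneous local Gibbs profile (`a₀ = 1`, `u₀ = 0`, `θ₀ = θ̄`) is a
function of the kinetic energy alone: `∏ᵢ M_{1,0,θ̄}(vᵢ) = (2πθ̄)^{-3(N+1)/2} exp(-E(z)/θ̄)`. -/
theorem tensorPow_homogeneous_eq (θb : ℝ) {n : ℕ} (z : Config n (Fin 3) T3) :
    tensorPow n (localGibbsProfile (fun _ => 1) (fun _ => (0 : V3)) (fun _ => θb)) z =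
      ((2 * Real.pi * θb) ^ (-(3 : ℝ) / 2)) ^ n * Real.exp (-(configEnergy z) / θb) := by
  unfold tensorPow localGibbsProfile localMaxwellian configEnergy
  simp only [one_mul, sub_zero, finrank_euclideanSpace, Fintype.card_fin, Nat.cast_ofNat]
  rw [Finset.prod_mul_distrib, Finset.prod_const, Finset.card_univ, Fintype.card_fin,
    ← Real.exp_sum]
  congr 1
  congr 1
  rw [Finset.mul_sum, neg_div, Finset.sum_div, ← Finset.sum_neg_distrib]
  refine Finset.sum_congr rfl fun i _ => ?_
  ring

/-- **The regularised flow leaves the homogeneous canonical density invariant at EVERY point**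
(energy conservation everywhere, `Alexander.configEnergy_regFlow`; the hard-sphere domain is
invariant because the good set is, and off the good set the regularised flow is the identity). -/
theorem canonicalDensity_homogeneous_regFlow {ε θb : ℝ} (hε : 0 < ε) (hε' : ε < 2⁻¹) {n : ℕ}
    (t : ℝ) (z : Config n (Fin 3) T3) :
    canonicalDensity (Torus.geometry (Fin 3)) ε n
        (localGibbsProfile (fun _ => 1) (fun _ => (0 : V3)) (fun _ => θb))
        (Alexander.regFlow (Torus.geometry (Fin 3)) ε t z) =
      canonicalDensity (Torus.geometry (Fin 3)) ε n
        (localGibbsProfile (fun _ => 1) (fun _ => (0 : V3)) (fun _ => θb)) z := by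
  unfold canonicalDensity
  congr 1
  by_cases hz : z ∈ Alexander.good (Torus.geometry (Fin 3)) ε
  · have hw : Alexander.regFlow (Torus.geometry (Fin 3)) ε t z ∈ Alexander.good (Torus.geometry (Fin 3)) ε :=
      Alexander.mapsTo_regFlow_good hε hε' t hz
    rw [Set.indicator_of_mem (Alexander.good_subset_hardSphereDomain hw),
      Set.indicator_of_mem (Alexander.good_subset_hardSphereDomain hz),
      tensorPow_homogeneous_eq, tensorPow_homogeneous_eq, Alexander.configEnergy_regFlow]
  · rw [Alexander.regFlow_of_not_mem hz]

/-- **The homogeneous local Gibbs law is invariant under the regularised hard-sphere flow**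
(`0 < σ < 1/2`, any `θ̄`, every `N`, every time): Liouville invariance
(`Alexander.measurePreserving_regFlow`) and pointwise invariance of the canonical density. -/
theorem measurePreserving_regFlow_localGibbsMeasure {σ : ℝ} (hσ : 0 < σ) (hσ2 : σ < 1 / 2)
    (θb : ℝ) (N : ℕ) (t : ℝ) :
    MeasurePreserving (Alexander.regFlow (N := N + 1) (Torus.geometry (Fin 3)) (hsDiameter σ N) t)
      (localGibbsMeasure σ (fun _ => 1) (fun _ => 0) (fun _ => θb) N)
      (localGibbsMeasure σ (fun _ => 1) (fun _ => 0) (fun _ => θb) N) := by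
  have hε : 0 < hsDiameter σ N := hsDiameter_pos hσ N
  have hε' : hsDiameter σ N < 2⁻¹ := (hsDiameter_le hσ.le N).trans_lt (by linarith)
  set Φ := Alexander.regHardSphereFlow (d := Fin 3) hε hε' (N + 1) with hΦ
  have hP : localGibbsMeasure σ (fun _ => 1) (fun _ => 0) (fun _ => θb) N =
      (liouville (Torus.geometry (Fin 3)) (N + 1) (hsDiameter σ N)).withDensity fun z =>
        ENNReal.ofReal (canonicalDensity (Torus.geometry (Fin 3)) (hsDiameter σ N) (N + 1)
          (localGibbsProfile (fun _ => 1) (fun _ => (0 : V3)) (fun _ => θb)) z) := by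
    rw [← localGibbsLaw_eq σ (fun _ => 1) (fun _ => 0) (fun _ => θb) N Φ]
    rfl
  rw [hP]
  refine measurePreserving_withDensity_of_comp_eq (Alexander.measurePreserving_regFlow hε hε' t)
    (measurable_canonicalDensity _ _
      (measurable_localGibbsProfile continuous_const continuous_const continuous_const)).ennreal_ofReal
    fun z => ?_
  simp only [canonicalDensity_homogeneous_regFlow hε hε' t z]

/-! ### Time averages along a measure-preserving flow: an abstract Markov–Tonelli bound -/

/-- **Small time-integrals force small values for half the time, which invariance makes as rare as
small values at time zero.**  Let `T s` (`s ∈ ℝ`) be maps preserving a probability measure `P`,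
jointly measurable in `(s, ω)`; let `F ≥ 0` be measurable with bounded orbits `s ↦ F (T s ω)`.
If `∫_{[0,t]} F (T s ω) ds ≤ M ≤ a t / 2` then `F (T s ω) ≤ a` for a set of times of measure
`≥ t/2` (Markov in `s`), and by Tonelli + invariance the `P`-measure of such `ω` is at most
`(2/t) ∫₀ᵗ P{F ∘ T_s ≤ a} ds = 2 P{F ≤ a}`. -/
theorem measure_setIntegral_orbit_le {Ω : Type*} [MeasurableSpace Ω] (P : Measure Ω)
    [IsProbabilityMeasure P] {T : ℝ → Ω → Ω} (hT : Measurable fun p : ℝ × Ω => T p.1 p.2)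
    (hinv : ∀ s, MeasurePreserving (T s) P P) {F : Ω → ℝ} (hF : Measurable F)
    (hF0 : ∀ ω, 0 ≤ F ω) (hbdd : ∀ ω, ∃ B, ∀ s, F (T s ω) ≤ B) {t a M : ℝ} (ht : 0 < t)
    (ha : 0 < a) (hM : M ≤ a * t / 2) :
    P {ω | ∫ s in Icc 0 t, F (T s ω) ≤ M} ≤ 2 * P {ω | F ω ≤ a} := by
  set μ : Measure ℝ := volume.restrict (Icc 0 t) with hμ
  haveI : IsFiniteMeasure μ := by rw [hμ]; infer_instance
  have hμuniv : μ univ = ENNReal.ofReal t := by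
    rw [hμ, Measure.restrict_apply_univ, Real.volume_Icc, sub_zero]
  -- the level set and its measurability
  set S : Set Ω := {ω | F ω ≤ a} with hS
  have hSm : MeasurableSet S := measurableSet_le hF measurable_const
  set K : Set (ℝ × Ω) := {p | F (T p.1 p.2) ≤ a} with hK
  have hKm : MeasurableSet K := measurableSet_le (hF.comp hT) measurable_const
  have hsec : ∀ ω, MeasurableSet {s : ℝ | F (T s ω) ≤ a} := fun ω =>
    measurableSet_le (hF.comp (hT.comp (measurable_id.prodMk measurable_const))) measurable_const
  -- the time spent below level `a`
  set G : Ω → ℝ≥0∞ := fun ω => μ {s | F (T s ω) ≤ a} with hG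
  have hGK : ∀ ω, G ω = ∫⁻ s, K.indicator 1 (s, ω) ∂μ := by
    intro ω
    rw [hG]
    simp only
    rw [← lintegral_indicator_one (hsec ω)]
    rfl
  have hGm : Measurable G := by
    have : G = fun ω => ∫⁻ s, K.indicator 1 (s, ω) ∂μ := funext hGK
    rw [this]
    exact (measurable_one.indicator hKm).lintegral_prod_left'
  -- Step 1: the event forces `G ω ≥ t/2`
  have hstep1 : {ω | ∫ s in Icc 0 t, F (T s ω) ≤ M} ⊆ {ω | ENNReal.ofReal (t / 2) ≤ G ω} := by
    intro ω hω
    simp only [mem_setOf_eq] at hω ⊢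
    obtain ⟨B, hB⟩ := hbdd ω
    have hfm : Measurable fun s => F (T s ω) :=
      hF.comp (hT.comp (measurable_id.prodMk measurable_const))
    have hfi : Integrable (fun s => F (T s ω)) μ :=
      Integrable.of_bound hfm.aestronglyMeasurable B (Eventually.of_forall fun s => by
        rw [Real.norm_eq_abs, abs_of_nonneg (hF0 _)]; exact hB s)
    -- Markov in `s`
    have hmk := mul_meas_ge_le_integral_of_nonneg (μ := μ) (Eventually.of_forall fun s => hF0 (T s ω))
      hfi a
    have hint : ∫ s, F (T s ω) ∂μ ≤ a * t / 2 := le_trans hω hM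
    have hreal : μ.real {s | a ≤ F (T s ω)} ≤ t / 2 := by
      have := le_trans hmk hint
      rw [show a * t / 2 = a * (t / 2) by ring] at this
      exact le_of_mul_le_mul_left this ha
    have hle_m : MeasurableSet {s | a ≤ F (T s ω)} := measurableSet_le measurable_const hfm
    -- complement
    have hcomp : {s | a ≤ F (T s ω)}ᶜ ⊆ {s | F (T s ω) ≤ a} := fun s hs => by
      simp only [mem_compl_iff, mem_setOf_eq, not_le] at hs
      exact hs.le
    have hGge : μ univ - μ {s | a ≤ F (T s ω)} ≤ G ω := by
      rw [hG]
      simp only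
      rw [← measure_compl hle_m (measure_ne_top μ _)]
      exact measure_mono hcomp
    refine le_trans ?_ hGge
    rw [hμuniv]
    have hfin : μ {s | a ≤ F (T s ω)} = ENNReal.ofReal (μ.real {s | a ≤ F (T s ω)}) :=
      (ENNReal.ofReal_toReal (measure_ne_top μ _)).symm
    rw [hfin, ← ENNReal.ofReal_sub _ measureReal_nonneg]
    exact ENNReal.ofReal_le_ofReal (by linarith)
  -- Step 2: Markov in `ω`
  have ht2 : ENNReal.ofReal (t / 2) ≠ 0 := (ENNReal.ofReal_pos.2 (by linarith)).ne'
  have hstep2 : P {ω | ENNReal.ofReal (t / 2) ≤ G ω} ≤ (∫⁻ ω, G ω ∂P) / ENNReal.ofReal (t / 2) :=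
    meas_ge_le_lintegral_div hGm.aemeasurable ht2 ENNReal.ofReal_ne_top
  -- Step 3: Tonelli + invariance
  have hstep3 : ∫⁻ ω, G ω ∂P = P S * ENNReal.ofReal t := by
    simp_rw [hGK]
    have hunc : Measurable (Function.uncurry fun ω s => K.indicator (1 : ℝ × Ω → ℝ≥0∞) (s, ω)) :=
      (measurable_one.indicator hKm).comp measurable_swap
    rw [lintegral_lintegral_swap hunc.aemeasurable]
    have hinner : ∀ s, ∫⁻ ω, K.indicator 1 (s, ω) ∂P = P S := by
      intro s
      have hpre : {ω | F (T s ω) ≤ a} = (T s) ⁻¹' S := rfl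
      have : (fun ω => K.indicator (1 : ℝ × Ω → ℝ≥0∞) (s, ω)) = ((T s) ⁻¹' S).indicator 1 := by
        funext ω
        rfl
      rw [this, lintegral_indicator_one (hSm.preimage (hinv s).measurable),
        (hinv s).measure_preimage hSm.nullMeasurableSet]
    simp_rw [hinner]
    rw [lintegral_const, hμuniv]
  -- Step 4: assemble
  calc P {ω | ∫ s in Icc 0 t, F (T s ω) ≤ M}
      ≤ P {ω | ENNReal.ofReal (t / 2) ≤ G ω} := measure_mono hstep1
    _ ≤ (∫⁻ ω, G ω ∂P) / ENNReal.ofReal (t / 2) := hstep2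
    _ = P S * ENNReal.ofReal t / ENNReal.ofReal (t / 2) := by rw [hstep3]
    _ = 2 * P S := by
        have h2 : ENNReal.ofReal t = 2 * ENNReal.ofReal (t / 2) := by
          rw [show (2 : ℝ≥0∞) = ENNReal.ofReal 2 by norm_num, ← ENNReal.ofReal_mul (by norm_num)]
          congr 1; ring
        rw [h2, ← mul_assoc, ENNReal.mul_div_cancel_right ht2 ENNReal.ofReal_ne_top, mul_comm]

end AprioriBoundsNegative

end Summit.AtomisticToContinuum.HydrodynamicLimit.Theorems

end
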